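import Summits.Ventures.HSemireg.Pad4TowerRuleDMu4

/-!
# Venture HSemireg — PAD-4 on 𝔅(μ₄): THEOREM FC1's static rule («charge-1 trigger») as a finite decidable predicate `FC1Mu4N ∕ FC1Mu4Closed`,
# next to `RuleDMu4N ∕ RuleDMu4Closed` — DEF-ONLY (PREP BYTES for director-hodge g13 R13.43 (3) «FC1 typed»; to be keyed on its trigger)

HONEST FRAMING. Lean index of the computation cell `pub-hsemireg` (S4-PUSH, H2 door PAD-4), typed by the Ventures-side typer
`hodge-lit-semireg-typer-2` (g5; line of record stmt-HodgeConjecture-18881 `Cruxes/BlochSeedDiscOne/Lines/birth.lean` 814a6a70c14e831a,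
stub `stub_rung_pad4_seedAt`). WHAT THIS FILE IS: the STATIC RULE «FC1» of the cell's W-SEARCH games — bc5-plan g3's **THEOREM FC1**
(BC5-PLAN-g3-MEMO.md c4d48c9f3885ee5e §13: «charge-1 trigger; any multiplicities, sections, layers») in the INSTANCE form the encoder of record
uses (s4-search-1 `xres2s.py` v19 c7ee80d7dccc0bfd, `fc1_generic(Z, present)`, a port of bc5-plan's `ruleD_universe2.fc1_clauses`) — typed
LITERALLY as a decidable predicate on the finite 𝔅(μ₄) configurations `MConfig` of `Pad4TowerCrossPhase`, in the vocabulary of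
`Pad4TowerRuleDMu4` (`MAgree`, `Sibling`, `MCoverAbove`), so that a K-free statement «STATIC ∧ … ⇒ ¬(A1) ∧ μ ≠ 0» (LINE 5, seed (B1):
attribution j302131 «V1 core_only = STATIC + FC-CORE UNSAT ×2», cell INBOX l.32378) can name `RuleDMu4Closed ∧ FC1Mu4Closed ∧ …` on its
hypothesis side. THE RULE (memo §13, THEOREM FC1, verbatim): «Let E be a two-level 𝔅(μ₄)-design satisfying (H2), and let X be a fully
charged N-constituent with a factor σ carrying x_σ = ℓ_ζ (c = 1, t = 0) and a factor f ≠ σ carrying a t-free letter; {τ, τ′} := the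
other two factors. Then (a) Q₀ := X(σ → O) IS a constituent (m(Q₀) > 0); (b) a BLOCKER is present: either (R-own∕R-anti) a
P-constituent P̂ = [O^{(σ)} | x_f | y | x_τ′] with y a letter on the null segment from x_τ (excluded) to x_τ(R) (included) of some
PRESENT N-constituent R = Q₀(τ → x_τ + d), d null …, or the same with τ ↔ τ′, or (R-N) an N-constituent Q₀(τ → x_τ + d, τ′ → x_τ′ + d′),
d, d′ null (an (r2a)-neighbour of Q₀ on (τ, τ′)).» THE ENCODER's reading fixed here (l.172–199 of the g23 copy 4e289008f4ef1da8, identical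
block in v19): the trigger is `is_ray0(Z[σ]) ∧ cabs = 1` (a UNIT t-free ray letter) and `is_ray0(Z[f])` (a t-free CHARGED letter) on an FC
N-class; (a) is `present('P', Q₀)` — Q₀ IS LOOKED UP AT LEVEL P (it is X's σ-leg partner below); the escort alternatives are
{R present as N, P-escort on the segment in the SAME null direction} and {the two-step N above Q₀ on (τ, τ′)}, any null directions.

CONTENT (DEF-ONLY + probes; no theorem about designs is claimed).
* `IsRay0 x` (t-free charged ray letter `lpt c k`, `c ≥ 1`), `IsUnitRay x` (`lpt 1 k`), `MCell.cancelAt Z σ` (`Q₀ = X(σ → O)`),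
  `FC1EscortP C Q t` (∃ present N-row `R = Q(t → x_t + k·n_w)` and present P-escort `Q(t → x_t + j·n_w)`, `1 ≤ j ≤ k`: `Sibling` twice, same
  direction), `FC1EscortN C Q t t′` (∃ present N two null steps above `Q` on `(t, t′)`: `MCoverAbove`), **`FC1Mu4N C Z`** (for all `σ ≠ f`
  with the trigger: `cancelAt Z σ ∈ C.upper` ∧ an escort over one of the two complementary factors), **`FC1Mu4Closed C`** (every fully
  charged N-cell passes), all `abbrev`s of decidable propositions; `fc1_probe` (`decide`: one FC N-cell with its cancellation and a
  P-escort present passes; removing the escort row or the cancellation fails).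

WHAT IS NOT HERE ∕ NOT IN LEAN. THEOREM FC1 itself ((H2) ⇒ the rule) — a pencil theorem of the cell about the first-order model, not
formalised (as for RULE D: the tree has no 𝔅 first-order model); the memo's finer case split of the escort letter `y` (own ∕ antipodal ∕
Pythagorean) is subsumed by «any null direction `w`, `1 ≤ j ≤ k`» exactly as in the encoder; the height bound `k < 12` of the encoder's search
is dropped (on a finite configuration the present cells bound it); no K-free LINE 5 statement (bc5-plan drafts it; this file only supplies the
predicate it will name); no SAT verdict, no object, no census row. NOTHING HERE SAYS THAT HC ∕ HC_CM ∕ HC_AV ∕ W₆ ∕ HC_Kum4Type HOLDS OR FAILS.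
No `instance`, no notation, no named fact, 0 `sorry`.

SOURCES (sha16 ∕ bus): BC5-PLAN-g3-MEMO.md c4d48c9f3885ee5e §13 THEOREM FC1 (l.86); xres2s.py v19 c7ee80d7dccc0bfd `fc1_generic` ∕ `is_ray0` ∕ `UN`
(s4push∕search-1∕code∕g24∕wg1∕; g23 copy 4e289008f4ef1da8 l.172–199, violation check l.539); director-hodge g13 R13.43 (3) l.32380, R13.48;
gs-eng-2 g52 l.32379 (C) «FC1 is NOT typed»; `Pad4TowerRuleDMu4.lean` (tree; `Sibling`, `MCoverAbove`, `RuleDMu4Closed`),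
`Pad4TowerCrossPhase.lean` (`MConfig`, `ray`, `lpt`, `MAgree`). -/

namespace Summit.Ventures.HSemireg.Pad4Tower

open Finset

/-! ## §1 The trigger letters and the cancellation -/

/-- a t-FREE CHARGED RAY LETTER `c·ℓ_{i^k}` (`α = c = |β| ≥ 1`; encoder `is_ray0`: `p[1] ≠ (0,0) ∧ p[0] = cabs(p)`). Decidable. -/
abbrev IsRay0 (x : BPoint) : Prop := 1 ≤ x.1 ∧ ∃ k : Fin 4, x = lpt x.1 k

/-- a UNIT t-free ray letter `ℓ_{i^k}` (charge `1`; encoder `is_ray0 ∧ cabs = 1`). Decidable. -/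
abbrev IsUnitRay (x : BPoint) : Prop := ∃ k : Fin 4, x = lpt 1 k

/-- the CANCELLATION `Q₀ = X(σ → O)`: the cell with its `σ`-letter replaced by `O`. -/
def MCell.cancelAt (Z : MCell) (σ : Fin 4) : MCell := Function.update Z σ (0, 0, 0)

/-! ## §2 The escorts and the rule -/

/-- the P-ESCORT alternative over the factor `t` of `Q` (memo (R-own∕R-anti); encoder: `rN` and `pe` both present): a PRESENT N-row
`R = Q(t → x_t + k·n_w)`, `k ≥ 1`, and a PRESENT P-escort `Q(t → x_t + j·n_w)` on the segment `1 ≤ j ≤ k`, same null direction `w`. -/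
abbrev FC1EscortP (C : MConfig) (Q : MCell) (t : Fin 4) : Prop :=
  ∃ R ∈ C.lower, ∃ E ∈ C.upper, ∃ w : Fin 4, Sibling Q R t w ∧ Sibling Q E t w ∧ (E t).1 ≤ (R t).1

/-- the N-ESCORT alternative over the pair `(t, t′)` (memo (R-N); encoder: `nn` present): a PRESENT N-cell two null steps above `Q`,
one on `t` and one on `t′`, any directions (an (r2a)-neighbour above: `MCoverAbove`). -/
abbrev FC1EscortN (C : MConfig) (Q : MCell) (t t' : Fin 4) : Prop := ∃ a b : Fin 4, MCoverAbove C Q t a t' b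

/-- **FC1 at an N-cell** (THEOREM FC1's conclusion as a static rule, encoder form): for every factor `σ` carrying a UNIT t-free ray
letter and every other factor `f` carrying a t-free charged letter, (a) the cancellation `Q₀ = Z(σ → O)` is a present P-cell, and
(b) over the two complementary factors `{t, t′}` an escort is present: a P-escort over `t` or over `t′`, or an N-escort over `(t, t′)`. -/
abbrev FC1Mu4N (C : MConfig) (Z : MCell) : Prop :=
  ∀ σ f : Fin 4, σ ≠ f → IsUnitRay (Z σ) → IsRay0 (Z f) →
    Z.cancelAt σ ∈ C.upper ∧
      ∃ t t' : Fin 4, t ≠ σ ∧ t ≠ f ∧ t' ≠ σ ∧ t' ≠ f ∧ t ≠ t' ∧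
        (FC1EscortP C (Z.cancelAt σ) t ∨ FC1EscortP C (Z.cancelAt σ) t' ∨ FC1EscortN C (Z.cancelAt σ) t t')

/-- **FC1-CLOSED configuration**: every FULLY CHARGED N-cell (all four letters charged; encoder: `side == 'N' and all p[1] != (0,0)`)
passes FC1. (The rule is vacuous at N-cells without a unit t-free letter next to another t-free letter.) -/
abbrev FC1Mu4Closed (C : MConfig) : Prop := ∀ Z ∈ C.lower, (∀ f, (Z f).2 ≠ (0, 0)) → FC1Mu4N C Z

/-! ## §3 Probes (`decide`) -/

/-- the probe cell `X = [ℓ₁ | 2ℓ₁ | T_{1,i³} | T_{1,i²}]` (fully charged; factor 0 the ONLY unit t-free letter, factor 1 the ONLY other t-free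
letter — the towers `T_{1,u} = 2I + ℓ_u = ray (2,0,0) k 1` are charged but not t-free —, so the rule is triggered exactly at `(σ, f) = (0, 1)`, `{t, t′} = {2, 3}`). -/
def fc1X : MCell := mcellOf (lpt 1 0) (lpt 2 0) (ray (2, 0, 0) 1 1) (ray (2, 0, 0) 2 1)

/-- its cancellation at factor 0, `Q₀ = [O | 2ℓ₁ | T_{1,i³} | T_{1,i²}]`. -/
def fc1Q : MCell := mcellOf (0, 0, 0) (lpt 2 0) (ray (2, 0, 0) 1 1) (ray (2, 0, 0) 2 1)

/-- an N-row two null steps up on factor 2 from `Q₀` (direction `n_{i¹}`) … -/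
def fc1R : MCell := mcellOf (0, 0, 0) (lpt 2 0) (ray (ray (2, 0, 0) 1 1) 1 2) (ray (2, 0, 0) 2 1)

/-- … and the P-escort one step up on the same segment. -/
def fc1E : MCell := mcellOf (0, 0, 0) (lpt 2 0) (ray (ray (2, 0, 0) 1 1) 1 1) (ray (2, 0, 0) 2 1)

/-- an N-cell two null steps above `Q₀`, one on factor 2 and one on factor 3 (the (R-N) escort). -/
def fc1NN : MCell := mcellOf (0, 0, 0) (lpt 2 0) (ray (ray (2, 0, 0) 1 1) 3 1) (ray (ray (2, 0, 0) 2 1) 0 1)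

/-- probe configuration: `X`, its cancellation `Q₀`, the N-row `R` and the P-escort `E` present. -/
def fc1CfgOK : MConfig := ⟨{fc1X, fc1R}, {fc1Q, fc1E}⟩

/-- the same without the P-escort. -/
def fc1CfgNoE : MConfig := ⟨{fc1X, fc1R}, {fc1Q}⟩

/-- the same without the cancellation. -/
def fc1CfgNoQ : MConfig := ⟨{fc1X, fc1R}, {fc1E}⟩

/-- `X`, `Q₀` and the (R-N) escort only. -/
def fc1CfgNN : MConfig := ⟨{fc1X, fc1NN}, {fc1Q}⟩

/-- the trigger letters of the probe cell: factor 0 is a unit t-free letter, factor 1 is t-free charged but not a unit, factors 2, 3 are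
charged towers (not t-free); `X` is fully charged; `cancelAt 0 = Q₀`.
[kernel, `decide`] -/
theorem fc1_probe_letters : IsUnitRay (fc1X 0) ∧ IsRay0 (fc1X 1) ∧ ¬ IsUnitRay (fc1X 1) ∧ ¬ IsRay0 (fc1X 2) ∧ ¬ IsRay0 (fc1X 3) ∧
    (∀ f, (fc1X f).2 ≠ (0, 0)) ∧ fc1X.cancelAt 0 = fc1Q := by
  refine ⟨by decide, by decide, by decide, by decide, by decide, by decide, by decide⟩

set_option synthInstance.maxSize 8192 in
set_option synthInstance.maxHeartbeats 2000000 in -- the unfolded predicate is one large decidable instance (as in `Pad4TowerRuleDMu4` §6)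
/-- PROBE (`decide`): with `Q₀`, the N-row `R` and the P-escort `E` present the whole configuration is FC1-CLOSED (`X` passes via the P-escort
over factor `2`; `R` is not fully charged, so the closure asks nothing of it). -/
theorem fc1_probe_ok : FC1Mu4Closed fc1CfgOK := by
  decide +kernel

set_option synthInstance.maxSize 8192 in
set_option synthInstance.maxHeartbeats 2000000 in -- as above
/-- PROBE (`decide`): dropping the P-escort `E`, or the cancellation `Q₀`, BREAKS FC1 at `X`. -/
theorem fc1_probe_fail : ¬ FC1Mu4N fc1CfgNoE fc1X ∧ ¬ FC1Mu4N fc1CfgNoQ fc1X := by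
  constructor <;> decide +kernel

set_option synthInstance.maxSize 8192 in
set_option synthInstance.maxHeartbeats 2000000 in -- as above
/-- PROBE (`decide`): the (R-N) escort alone (with `Q₀`) also passes FC1 at `X`. -/
theorem fc1_probe_nn : FC1Mu4N fc1CfgNN fc1X := by
  decide +kernel

end Summit.Ventures.HSemireg.Pad4Tower
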